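import Summits.QuantumFields.QCD.Theses.NestedDissectionSea
import Summits.QuantumFields.QCD.Theorems.NestedDissectionSeaCoerciveSeaWindowShrink
import Summits.QuantumFields.QCD.Theorems.NestedDissectionSeaCoerciveOfDilute

/-!
# Line `Sketch` (cards `sea-pays-its-own-poles` + `two-regime-splice`) — skeleton v1 (lead 0, 2026-08-17) for the
# crux `CoerciveOfDilute` (stmt-QuantumFields-14759)

Route `NestedDissectionSea`, crux `Summit.QuantumFields.QCD.Theses.NestedDissectionSea.CoerciveOfDilute :=
NegativeCellsDilute → CoerciveSea`, whose content is clause (i) of the hinge (the SEPARATOR WEGNER LAW in the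
window, `P_pq(HasSingularSeparator U m_f(k) s (t/s₀)) ≤ C t^α`) along a dilution-certified regularisation = the
registered open stub `stub_separatorLawLarge` of 13901's built line `chirality-collapses-pseudospectrum`.

## The line (PICKED.md): the sea pays its own poles, on the coarse levels; a fixed-cutoff bound splices in below

* (M_Σ) `TorusSheetMoment` — `E_pq ‖(D_T(m_f(k))⁻¹)_ΣΣ‖ ≤ C s₀`: the phase-quenched weight `∏_f |det D_T(m_f)|`
  contains `σ_min` of the torus Schur complement onto the cell's separator `Σ` as an exact factor, so the mean of the
  torus propagator AT THE SEA MASS compressed to `Σ` is finite with no input; the content is the `k`-uniform size.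
* (T) `WallTransfer` — a `(t/s₀)`-singular DIRICHLET separator forces `‖(D_T⁻¹)_ΣΣ‖ > s₀/(C_w t)` off an event of
  probability `≤ B t^{α_w}`, for the coarse levels `t ∈ [a_k^γ, 1]` (second-order wall shift; reshaped by this lead
  from the card's `B a_k^γ t^{-γ'}`, see the def).
* (F) `FineRegimeLaw` — `P_pq ≤ B a_k^{-p} t^{α₀}` on all of `(0,1]` (fixed-cutoff Wegner, polynomial loss allowed).
* Bookkeeping, PROVABLE NOW: `SheetGreenIntegrable` (measurability + integrability of `‖(D_T(m_f)⁻¹)_ΣΣ‖·wt`);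
  `stub_coarseOfMomentAndTransfer : SheetGreenIntegrable → (M_Σ) → (T) → CoarseLaw` (Markov in ratio form,
  `ratio_markov` below, + a union bound over the two measurable events); `stub_lawOfCoarseAndFine : CoarseLaw →
  (F) → SeparatorLawOnBranch` (`splice` below with `t₁ = a_k^γ`, `separatorRatio_mono` p132904, `a_k → 0`).
* Transfer, SORRY-FREE HERE: `SeparatorLawOnBranch → SeparatorLawLarge` (weakening: `M₁ = M₀`, `ℓ' = ℓ`,
  `b₀ ≤ s_i ⇒ 2 ≤ s_i`), then `CoerciveSea` by the LANDED composition
  `coerciveSea_of_pinnedDilutionOnBranch_of_separatorLawLarge` (p108820) with the EXTERNAL import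
  `stub_pinnedDilutionOnPhysicalBranch` (= item 13900 + the physical-branch clause; the same registered external stub
  as in 13901's line — never briefed), then the crux by `coerciveOfDilute_of_coerciveSea` (p87837).

Why the hypothesis `NegativeCellsDilute` is consumed through the external import and not through the binder: the
law is only claimed (and only plausible) along PHYSICAL-BRANCH regularisations (`mcrit k → 0`); the binder's witness
carries no branch clause, and off the branch clause (i) at small leaves is FALSE
(`separatorLaw_false_of_pin_of_cluster_neg_four`, p93225). The tenure action "add `Tendsto reg.mcrit atTop (nhds 0)`
to 13900" (13901 leads c1–c5, 14759 seats 0–3) turns the import into 13900 itself; until then the line closes the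
crux exactly as 13901's line closes the hinge — modulo 13900-on-branch.

Stubs (7 = stubs_max): research `stub_torusSheetMoment` (MINE, hardest), `stub_wallTransfer`, `stub_fineRegimeLaw`;
provable `stub_sheetGreenIntegrable`, `stub_coarseOfMomentAndTransfer`, `stub_lawOfCoarseAndFine`; external
`stub_pinnedDilutionOnPhysicalBranch`. `sorry` only in `stub_*`; `CoerciveOfDilute_of` concludes the crux BY NAME.

Vocabulary: the `def`s of §0–§2 are byte-identical to the proposed module
`Theorems/NestedDissectionSeaCoerciveOfDiluteLineDefs.lean` (p134400, in review); when it lands this file imports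
it and drops the local copies (same namespace, same names).

## Disproof used
`payload.disproof_path` (`run/sessions/refuter-cdisprove-stmt-QuantumFields-14759-0/folder/Disproof.lean`) does not
exist at seating (2026-08-17T00:36Z; `ledger crux ls`: no `Disproof.lean`). Standing analysis = the parent's
`Cruxes/CoerciveSea/Disproof.lean` v4 (NO KILL) and the landed 14759 supports: Part C (content enters through the
pin) and p93225 (off-branch exposure) ⇒ every statement here lives on the physical branch and on boxes with all
sides `≥ S₀`; Part D (fixed-`k` Łojasiewicz; "the content is uniformity") ⇒ (F) is exactly that statement with the
constant's growth controlled, and uniformity is owed only on `[a_k^γ, 1]` (the splice); Part B/G (separator event ⊆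
cell pseudomode) ⇒ used inside (T). No `_false_without_` theorem or `-- Targets` section exists for this crux yet.
-/

noncomputable section

open scoped BigOperators Classical Matrix.Norms.L2Operator
open MeasureTheory Filter Matrix
open Literature.MathematicalPhysics.QuantumLattice Literature.MathematicalPhysics.QuantumFieldTheory
  Literature.Probability.LatticeModels
open Summit.QuantumFields.QCD.Theorems.NestedDissectionSeaCoerciveOfDilute
open Summit.QuantumFields.QCD.Cruxes.CoerciveSea.ChiralityCollapsesPseudospectrum

namespace Summit.QuantumFields.QCD.Cruxes.CoerciveOfDilute.SeaPaysPoles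

/-! ## §0–§2 Vocabulary (local copy of `Theorems/NestedDissectionSeaCoerciveOfDiluteLineDefs.lean`, p134400 in review) -/

section Vocabulary

variable {N : ℕ} [NeZero N]

/-- The internal separator `Σ` of the corner-`0` open box of sides `s` (the box minus its sixteen children
interiors), as a predicate on the FULL Wilson index set of the torus (site, colour, spin). -/
def sheet (s : Fin 4 → ℕ) (p : TorusSite 4 N × Fin 3 × Fin 4) : Prop :=
  wilsonBox (0 : TorusSite 4 N) s p ∧ ∀ ε : Fin 4 → Bool, ¬ wilsonBox (halfCorner s ε) (halfSides s ε) p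

/-- The TORUS quark propagator `D_T(μ)⁻¹` (full periodic `r = 1` Wilson–Dirac matrix of the torus, fundamental
`SU(3)`, Mathlib's nonsingular inverse — junk `0` when `det D_T(μ) = 0`) compressed to the internal separator of
the corner-`0` box of sides `s`: `(D_T(μ)⁻¹)_ΣΣ`. When `D_T(μ)` is invertible its inverse is the Schur complement
of the torus matrix onto `Σ`. -/
def torusSheetGreen (U : GaugeConfig 4 N (Matrix.specialUnitaryGroup (Fin 3) ℂ)) (μ : ℝ) (s : Fin 4 → ℕ) :
    Matrix {p // sheet (N := N) s p} {p // sheet (N := N) s p} ℂ :=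
  (wilsonDirac (fundamentalRep (Fin 3)) U μ 1)⁻¹.toBlock (sheet s) (sheet s)

omit [NeZero N] in
/-- `sheet s` is exactly the crux's internal separator `{p ∈ box | ¬ childrenInterior s p}` read on the ambient
index set. -/
theorem sheet_iff (s : Fin 4 → ℕ) (p : TorusSite 4 N × Fin 3 × Fin 4) :
    sheet (N := N) s p ↔ ∃ h : wilsonBox (0 : TorusSite 4 N) s p, ¬ childrenInterior s ⟨p, h⟩ := by
  simp only [sheet, childrenInterior, not_exists]
  constructor
  · rintro ⟨h, h'⟩; exact ⟨h, h'⟩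
  · rintro ⟨h, h'⟩; exact ⟨h, h'⟩

end Vocabulary

/-- Local notation: the colour group `SU(3)`. -/
local notation "𝔾" => Matrix.specialUnitaryGroup (Fin 3) ℂ

/-! ## §1 The statements of the line -/

/-- **(M_Σ) `TorusSheetMoment`** — the heart of card `sea-pays-its-own-poles`. Along every admissible
regularisation on the physical branch (`HasMassScaling`, `HasAsymptoticScaling`, `mcrit k → 0`), for every
physical window `ℓ > 0` and positive mass tuple there are `R > 0`, a minimal side `S₀` and `C > 0` such that,
eventually in `k`, on every odd torus of physical side `≥ R`, for every roughly cubic corner-`0` window box with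
all sides `≥ S₀` and every flavour `f`, the PHASE-QUENCHED MEAN of the operator norm of the torus quark
propagator AT THE SEA MASS `m_f(k)` compressed to the cell's internal separator is at most `C s₀`:
`E_pq ‖(D_T(m_f(k))⁻¹)_ΣΣ‖ ≤ C · s 0`. The integrand `‖(D_T⁻¹)_ΣΣ‖ · ∏_f |det D_T(m_f)|` is bounded and
measurable (`SheetGreenIntegrable`), so the mean is an honest Bochner ratio; the content is the `k`-UNIFORM size
(bulk `O(log s₀)` by a deterministic high-mode cut, physical modes `O(Z_m)`, each artefact carrier `O(ρ_*)`,
`ρ_* ∝ a_k^{-1/2} ≪ s₀ ∝ a_k^{-1}`). -/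
def TorusSheetMoment : Prop :=
  ∀ (Nf : ℕ) (reg : QCDRegularisation Nf), (Nf = 2 ∨ Nf = 3) → reg.HasMassScaling →
    (reg.scheme 0 0 0).HasAsymptoticScaling → Tendsto reg.mcrit atTop (nhds 0) →
    ∀ ℓ : ℝ, 0 < ℓ → ∀ m : Fin Nf → ℝ, (∀ f, 0 < m f) →
    ∃ R : ℝ, 0 < R ∧ ∃ S₀ : ℕ, ∃ C : ℝ, 0 < C ∧ ∀ᶠ k : ℕ in atTop, ∀ S : ℕ, R ≤ reg.a k * (2 * S + 1) →
      let N : ℕ := 2 * S + 1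
      let mq : Fin Nf → ℝ := fun f => reg.mcrit k + reg.a k * m f / reg.Zm k
      let wt : GaugeConfig 4 N 𝔾 → ℝ := fun U => ∏ f, ‖fermionDet (wilsonDirac (fundamentalRep (Fin 3)) U (mq f) 1)‖
      let E : (GaugeConfig 4 N 𝔾 → ℝ) → ℝ := fun F =>
        (∫ U, F U * wt U ∂(wilsonMeasure (d := 4) (L := N) (fundamentalRep (Fin 3)) (reg.β k))) /
          (∫ U, wt U ∂(wilsonMeasure (d := 4) (L := N) (fundamentalRep (Fin 3)) (reg.β k)))
      ∀ s : Fin 4 → ℕ, (∀ i, 2 ≤ s i ∧ s i ≤ N ∧ (s i : ℝ) * reg.a k ≤ ℓ) → (∀ i, S₀ ≤ s i) →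
        (∀ i j, s i ≤ 2 * s j) → ∀ f : Fin Nf,
        E (fun U => ‖torusSheetGreen U (mq f) s‖) ≤ C * s 0

/-- **(T) `WallTransfer`** — Dirichlet separator singular ⇒ torus sheet propagator large, off an exceptional
event of power-law small probability, on the COARSE levels only (reshaped by the lead from the card's
`B a_k^γ t^{-γ'}` to the weaker `B t^{α_w}` on `t ∈ [a_k^γ, 1]`, which is all the composition consumes). Along
every physical-branch admissible regularisation, positive tuple and window there are `R > 0`, `S₀`, `C_w ≥ 1`,
`γ > 0`, `α_w > 0`, `B ≥ 0` such that eventually in `k`, on large tori, for large roughly cubic window boxes,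
every flavour and every coarse level `t ∈ [a_k^γ, 1]`: the phase-quenched probability that the separator is
`(t/s₀)`-singular (the crux's event) WHILE the torus propagator compressed to the same separator stays below
`s₀/(C_w t)` is `≤ B t^{α_w}`. Mechanism (card): a sub-gap Dirichlet direction is torus-visible up to the
second-order wall shift `≍ ‖K‖²θ`, `θ` its mass on the outer wall layer; the exceptional set is "a carrier within
`ρ_*(C s₀/t)^{1/3}` of the outer wall", a fraction `≍ a_k^{1/6} t^{-1/3} ≤ t^{1/(6γ) - 1/3}` of positions. -/
def WallTransfer : Prop :=
  ∀ (Nf : ℕ) (reg : QCDRegularisation Nf), (Nf = 2 ∨ Nf = 3) → reg.HasMassScaling →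
    (reg.scheme 0 0 0).HasAsymptoticScaling → Tendsto reg.mcrit atTop (nhds 0) →
    ∀ ℓ : ℝ, 0 < ℓ → ∀ m : Fin Nf → ℝ, (∀ f, 0 < m f) →
    ∃ R : ℝ, 0 < R ∧ ∃ S₀ : ℕ, ∃ Cw : ℝ, 1 ≤ Cw ∧ ∃ γ : ℝ, 0 < γ ∧ ∃ αw : ℝ, 0 < αw ∧ ∃ B : ℝ, 0 ≤ B ∧
      ∀ᶠ k : ℕ in atTop, ∀ S : ℕ, R ≤ reg.a k * (2 * S + 1) →
      let N : ℕ := 2 * S + 1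
      let mq : Fin Nf → ℝ := fun f => reg.mcrit k + reg.a k * m f / reg.Zm k
      let wt : GaugeConfig 4 N 𝔾 → ℝ := fun U => ∏ f, ‖fermionDet (wilsonDirac (fundamentalRep (Fin 3)) U (mq f) 1)‖
      let P : (GaugeConfig 4 N 𝔾 → Prop) → ℝ := fun Ev =>
        (∫ U, (if Ev U then (1 : ℝ) else 0) * wt U ∂(wilsonMeasure (d := 4) (L := N) (fundamentalRep (Fin 3)) (reg.β k))) /
          (∫ U, wt U ∂(wilsonMeasure (d := 4) (L := N) (fundamentalRep (Fin 3)) (reg.β k)))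
      ∀ s : Fin 4 → ℕ, (∀ i, 2 ≤ s i ∧ s i ≤ N ∧ (s i : ℝ) * reg.a k ≤ ℓ) → (∀ i, S₀ ≤ s i) →
        (∀ i j, s i ≤ 2 * s j) → ∀ f : Fin Nf, ∀ t : ℝ, reg.a k ^ γ ≤ t → t ≤ 1 →
        P (fun U => HasSingularSeparator U (mq f) s (t / s 0) ∧
            ‖torusSheetGreen U (mq f) s‖ ≤ (s 0 : ℝ) / (Cw * t)) ≤ B * t ^ αw

/-- **`CoarseLaw`** — clause (i) on the COARSE levels only: `P_pq(HasSingularSeparator U m_f(k) s (t/s₀)) ≤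
A t^α` for `t ∈ [a_k^γ, 1]`, on large roughly cubic window boxes, along every physical-branch admissible
regularisation and positive tuple. (M_Σ) ∧ (T) give it by Markov and a union bound
(`stub_coarseOfMomentAndTransfer`). -/
def CoarseLaw : Prop :=
  ∀ (Nf : ℕ) (reg : QCDRegularisation Nf), (Nf = 2 ∨ Nf = 3) → reg.HasMassScaling →
    (reg.scheme 0 0 0).HasAsymptoticScaling → Tendsto reg.mcrit atTop (nhds 0) →
    ∀ ℓ : ℝ, 0 < ℓ → ∀ m : Fin Nf → ℝ, (∀ f, 0 < m f) →
    ∃ R : ℝ, 0 < R ∧ ∃ S₀ : ℕ, ∃ γ : ℝ, 0 < γ ∧ ∃ A : ℝ, 0 < A ∧ ∃ α : ℝ, 0 < α ∧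
      ∀ᶠ k : ℕ in atTop, ∀ S : ℕ, R ≤ reg.a k * (2 * S + 1) →
      let N : ℕ := 2 * S + 1
      let mq : Fin Nf → ℝ := fun f => reg.mcrit k + reg.a k * m f / reg.Zm k
      let wt : GaugeConfig 4 N 𝔾 → ℝ := fun U => ∏ f, ‖fermionDet (wilsonDirac (fundamentalRep (Fin 3)) U (mq f) 1)‖
      let P : (GaugeConfig 4 N 𝔾 → Prop) → ℝ := fun Ev =>
        (∫ U, (if Ev U then (1 : ℝ) else 0) * wt U ∂(wilsonMeasure (d := 4) (L := N) (fundamentalRep (Fin 3)) (reg.β k))) /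
          (∫ U, wt U ∂(wilsonMeasure (d := 4) (L := N) (fundamentalRep (Fin 3)) (reg.β k)))
      ∀ s : Fin 4 → ℕ, (∀ i, 2 ≤ s i ∧ s i ≤ N ∧ (s i : ℝ) * reg.a k ≤ ℓ) → (∀ i, S₀ ≤ s i) →
        (∀ i j, s i ≤ 2 * s j) → ∀ f : Fin Nf, ∀ t : ℝ, reg.a k ^ γ ≤ t → t ≤ 1 →
        P (fun U => HasSingularSeparator U (mq f) s (t / s 0)) ≤ A * t ^ α

/-- **(F) `FineRegimeLaw`** — the FIXED-CUTOFF Wegner bound with polynomially lossy constants: the crux's event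
obeys `P_pq ≤ B a_k^{-p} t^{α₀}` for ALL `t ∈ (0,1]`, with `B, p, α₀` independent of `k`, volume and box (the
constant may blow up like a power of `1/a_k`, the exponent may not degrade). Intended engine (card
`two-regime-splice`): single-link Haar / Erdős–Hasler smearing at fixed `β_k`, conditional one-link density
`≤ e^{12β_k}(2·48+1)^{N_f} ×` Haar by Nikolskii with `e^{12β_k}` polynomial in `1/a_k` by asymptotic scaling, and a
squared-gradient floor `≥ 1/poly(s)`. -/
def FineRegimeLaw : Prop :=
  ∀ (Nf : ℕ) (reg : QCDRegularisation Nf), (Nf = 2 ∨ Nf = 3) → reg.HasMassScaling →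
    (reg.scheme 0 0 0).HasAsymptoticScaling → Tendsto reg.mcrit atTop (nhds 0) →
    ∀ ℓ : ℝ, 0 < ℓ → ∀ m : Fin Nf → ℝ, (∀ f, 0 < m f) →
    ∃ R : ℝ, 0 < R ∧ ∃ S₀ : ℕ, ∃ p : ℝ, 0 ≤ p ∧ ∃ B : ℝ, 0 < B ∧ ∃ α₀ : ℝ, 0 < α₀ ∧
      ∀ᶠ k : ℕ in atTop, ∀ S : ℕ, R ≤ reg.a k * (2 * S + 1) →
      let N : ℕ := 2 * S + 1
      let mq : Fin Nf → ℝ := fun f => reg.mcrit k + reg.a k * m f / reg.Zm k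
      let wt : GaugeConfig 4 N 𝔾 → ℝ := fun U => ∏ f, ‖fermionDet (wilsonDirac (fundamentalRep (Fin 3)) U (mq f) 1)‖
      let P : (GaugeConfig 4 N 𝔾 → Prop) → ℝ := fun Ev =>
        (∫ U, (if Ev U then (1 : ℝ) else 0) * wt U ∂(wilsonMeasure (d := 4) (L := N) (fundamentalRep (Fin 3)) (reg.β k))) /
          (∫ U, wt U ∂(wilsonMeasure (d := 4) (L := N) (fundamentalRep (Fin 3)) (reg.β k)))
      ∀ s : Fin 4 → ℕ, (∀ i, 2 ≤ s i ∧ s i ≤ N ∧ (s i : ℝ) * reg.a k ≤ ℓ) → (∀ i, S₀ ≤ s i) →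
        (∀ i j, s i ≤ 2 * s j) → ∀ f : Fin Nf, ∀ t : ℝ, 0 < t → t ≤ 1 →
        P (fun U => HasSingularSeparator U (mq f) s (t / s 0)) ≤ B * (reg.a k) ^ (-p) * t ^ α₀

/-- **`SeparatorLawOnBranch`** — the line's target: clause (i) of `CoerciveSea` on large roughly cubic window
boxes, for ALL `t ∈ (0,1]`, along every physical-branch admissible regularisation and every positive tuple
(the conclusion of 13901's registered `stub_separatorLawLarge` freed of its pinned-dilute hypothesis and read at
zero threshold). `CoarseLaw ∧ FineRegimeLaw` give it by the splice (`stub_lawOfCoarseAndFine`); it implies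
`SeparatorLawLarge` by weakening. -/
def SeparatorLawOnBranch : Prop :=
  ∀ (Nf : ℕ) (reg : QCDRegularisation Nf), (Nf = 2 ∨ Nf = 3) → reg.HasMassScaling →
    (reg.scheme 0 0 0).HasAsymptoticScaling → Tendsto reg.mcrit atTop (nhds 0) →
    ∀ ℓ : ℝ, 0 < ℓ → ∀ m : Fin Nf → ℝ, (∀ f, 0 < m f) →
    ∃ R : ℝ, 0 < R ∧ ∃ S₀ : ℕ, ∃ C : ℝ, 0 < C ∧ ∃ α : ℝ, 0 < α ∧
      ∀ᶠ k : ℕ in atTop, ∀ S : ℕ, R ≤ reg.a k * (2 * S + 1) →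
      let N : ℕ := 2 * S + 1
      let mq : Fin Nf → ℝ := fun f => reg.mcrit k + reg.a k * m f / reg.Zm k
      let wt : GaugeConfig 4 N 𝔾 → ℝ := fun U => ∏ f, ‖fermionDet (wilsonDirac (fundamentalRep (Fin 3)) U (mq f) 1)‖
      let P : (GaugeConfig 4 N 𝔾 → Prop) → ℝ := fun Ev =>
        (∫ U, (if Ev U then (1 : ℝ) else 0) * wt U ∂(wilsonMeasure (d := 4) (L := N) (fundamentalRep (Fin 3)) (reg.β k))) /
          (∫ U, wt U ∂(wilsonMeasure (d := 4) (L := N) (fundamentalRep (Fin 3)) (reg.β k)))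
      ∀ s : Fin 4 → ℕ, (∀ i, 2 ≤ s i ∧ s i ≤ N ∧ (s i : ℝ) * reg.a k ≤ ℓ) → (∀ i, S₀ ≤ s i) →
        (∀ i j, s i ≤ 2 * s j) → ∀ f : Fin Nf, ∀ t : ℝ, 0 < t → t ≤ 1 →
        P (fun U => HasSingularSeparator U (mq f) s (t / s 0)) ≤ C * t ^ α

/-- **`SheetGreenIntegrable`** — the bookkeeping behind Markov on (M_Σ): (a) the operator norm of the compressed
torus propagator is a measurable function of the gauge field; (b) AT A SEA MASS `μ = m_f` the integrand
`‖(D_T(m_f)⁻¹)_ΣΣ‖ · ∏_{f'} |det D_T(m_{f'})|` is integrable against the Wilson measure — indeed bounded: for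
`det D_T(m_f) ≠ 0`, `|det D_T(m_f)| · (D_T(m_f)⁻¹)_ΣΣ = (adj D_T(m_f))_ΣΣ` is polynomial in the (bounded) link
entries, and Mathlib's inverse is `0` on `{det = 0}`. (The pole is NOT cancelled at a valence mass `μ ∉ {m_f}`,
where `1/|det D_T(μ)|` is not locally integrable across the real hypersurface `{det = 0}`; hence the restriction.)
Provable now. -/
def SheetGreenIntegrable : Prop :=
  (∀ (N : ℕ) [NeZero N] (μ : ℝ) (s : Fin 4 → ℕ),
      Measurable fun U : GaugeConfig 4 N 𝔾 => ‖torusSheetGreen U μ s‖) ∧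
  ∀ (N : ℕ) [NeZero N] (β : ℝ) (Nf : ℕ) (mq : Fin Nf → ℝ) (s : Fin 4 → ℕ) (f : Fin Nf),
      Integrable (fun U : GaugeConfig 4 N 𝔾 =>
          ‖torusSheetGreen U (mq f) s‖ * ∏ f', ‖fermionDet (wilsonDirac (fundamentalRep (Fin 3)) U (mq f') 1)‖)
        (wilsonMeasure (d := 4) (L := N) (fundamentalRep (Fin 3)) β)

/-! ## §2 The two statements of crux 13901's built line through which this line reaches the crux -/

/-- **`PinnedDilutionOnPhysicalBranch`** — VERBATIM the type of the registered external stub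
`stub_pinnedDilutionOnPhysicalBranch` of `Cruxes/CoerciveSea/Lines/chirality_collapses_pseudospectrum.lean`
(= item `NegativeCellsDilute` stmt-13900 WITH the physical-branch clause `mcrit k → 0` for the same witness;
open, external to this line — never briefed). For `N_f ∈ {2,3}` there is ONE admissible regularisation on the
physical branch with `M₀ ≥ 0`, `b₀ ≥ 2`, `ℓ > 0` such that every tuple `m > M₀` has a size `R > 0` with
(ii) windowed local dilution and (iii) the parity pin, both verbatim the clauses of `NegativeCellsDilute`. -/
def PinnedDilutionOnPhysicalBranch : Prop :=
  ∀ Nf : ℕ, (Nf = 2 ∨ Nf = 3) → ∃ reg : QCDRegularisation Nf, reg.HasMassScaling ∧ (reg.scheme 0 0 0).HasAsymptoticScaling ∧ Filter.Tendsto reg.mcrit Filter.atTop (nhds 0) ∧ ∃ M₀ : ℝ, 0 ≤ M₀ ∧ ∃ b₀ : ℕ, 2 ≤ b₀ ∧ ∃ ℓ : ℝ, 0 < ℓ ∧ ∀ m : Fin Nf → ℝ, (∀ f, M₀ < m f) → ∃ R : ℝ, 0 < R ∧ (∀ ε : ℝ, 0 < ε → ∀ᶠ k : ℕ in Filter.atTop,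 ∀ S : ℕ, R ≤ reg.a k * (2 * S + 1) → let N : ℕ := 2 * S + 1; let mq : Fin Nf → ℝ := fun f => reg.mcrit k + reg.a k * m f / reg.Zm k; let wt : GaugeConfig 4 N (Matrix.specialUnitaryGroup (Fin 3) ℂ) → ℝ := fun U => ∏ f, ‖fermionDet (wilsonDirac (fundamentalRep (Fin 3)) U (mq f) 1)‖; let P : (GaugeConfig 4 N (Matrix.specialUnitaryGroup (Fin 3) ℂ) → Prop) → ℝ := fun E => (∫ U, (if E U then (1 : ℝ) else 0) * wt U ∂(wilsonMeasure (d := 4) (L := N) (fundamentalRep (Fin 3)) (reg.β k))) / (∫ U, wt U ∂(wilsonMeasure (d := 4) (L := N) (fundamentalRep (Fin 3)) (reg.β k))); let J : ℕ := Nat.log 2 (⌊ℓ / reg.a k⌋₊ / b₀) + 1; ∃ δ : ℕ → ℝ, ∑ j ∈ Finset.range J, δ j ≤ ε ∧ ∀ j < J, ∀ s : Fin 4 → ℕ, (∀ i, b₀ * 2 ^ j ≤ s i ∧ s i < b₀ * 2 ^ (j + 2) ∧ s i ≤ N ∧ (s i : ℝ) * reg.a k ≤ ℓ) → P (fun U =>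 ∃ f, IsSignDefect U (mq f) j s) ≤ δ j) ∧ (∀ M : ℝ, M₀ < M → ∀ᶠ k : ℕ in Filter.atTop, ∀ S : ℕ, R ≤ reg.a k * (2 * S + 1) → let N : ℕ := 2 * S + 1; let mq : Fin Nf → ℝ := fun f => reg.mcrit k + reg.a k * m f / reg.Zm k; let wt : GaugeConfig 4 N (Matrix.specialUnitaryGroup (Fin 3) ℂ) → ℝ := fun U => ∏ f, ‖fermionDet (wilsonDirac (fundamentalRep (Fin 3)) U (mq f) 1)‖; (1 / 4 : ℝ) ≤ (∫ U, (if (fermionDet (wilsonDirac (fundamentalRep (Fin 3)) U (reg.mcrit k - reg.a k * M / reg.Zm k) 1)).re < 0 then (1 : ℝ) else 0) * wt U ∂(wilsonMeasure (d := 4) (L := N) (fundamentalRep (Fin 3)) (reg.β k))) / (∫ U, wt U ∂(wilsonMeasure (d := 4) (L := N) (fundamentalRep (Fin 3)) (reg.β k))))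

/-- **`SeparatorLawLarge`** — VERBATIM the type of the registered open stub `stub_separatorLawLarge` of
`Cruxes/CoerciveSea/Lines/chirality_collapses_pseudospectrum.lean` (clause (i) on large window boxes along every
physical-branch regularisation carrying the pinned-dilute body; the research content shared by cruxes 13901 and
14759). `SeparatorLawOnBranch` implies it by weakening (`separatorLawLarge_of_onBranch` in the skeleton); with
`PinnedDilutionOnPhysicalBranch` it gives `CoerciveSea` by the landed composition p108820. -/
def SeparatorLawLarge : Prop :=
  ∀ (Nf : ℕ) (reg : QCDRegularisation Nf), (Nf = 2 ∨ Nf = 3) → reg.HasMassScaling → (reg.scheme 0 0 0).HasAsymptoticScaling → Filter.Tendsto reg.mcrit Filter.atTop (nhds 0) → ∀ M₀ : ℝ, 0 ≤ M₀ → ∀ b₀ : ℕ, 2 ≤ b₀ → ∀ ℓ : ℝ, 0 < ℓ → (∀ m : Fin Nf → ℝ, (∀ f, M₀ < m f) → ∃ R : ℝ, 0 < R ∧ (∀ ε : ℝ, 0 < ε → ∀ᶠ k : ℕ in Filter.atTop, ∀ S : ℕ, R ≤ reg.a k * (2 * S + 1) → let N : ℕ := 2 * S + 1; let mq : Fin Nf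 → ℝ := fun f => reg.mcrit k + reg.a k * m f / reg.Zm k; let wt : GaugeConfig 4 N (Matrix.specialUnitaryGroup (Fin 3) ℂ) → ℝ := fun U => ∏ f, ‖fermionDet (wilsonDirac (fundamentalRep (Fin 3)) U (mq f) 1)‖; let P : (GaugeConfig 4 N (Matrix.specialUnitaryGroup (Fin 3) ℂ) → Prop) → ℝ := fun E => (∫ U, (if E U then (1 : ℝ) else 0) * wt U ∂(wilsonMeasure (d := 4) (L := N) (fundamentalRep (Fin 3)) (reg.β k))) / (∫ U, wt U ∂(wilsonMeasure (d := 4) (L := N) (fundamentalRep (Fin 3)) (reg.β k))); let J : ℕ := Nat.log 2 (⌊ℓ / reg.a k⌋₊ / b₀) + 1; ∃ δ : ℕ → ℝ, ∑ j ∈ Finset.range J, δ j ≤ ε ∧ ∀ j < J, ∀ s : Fin 4 → ℕ, (∀ i, b₀ * 2 ^ j ≤ s i ∧ s i < b₀ * 2 ^ (j + 2) ∧ s i ≤ N ∧ (s i : ℝ) * reg.a k ≤ ℓ) → P (fun U => ∃ f, IsSignDefect U (mq f) j s) ≤ δ j) ∧ (∀ M : ℝ, M₀ < M → ∀ᶠ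 k : ℕ in Filter.atTop, ∀ S : ℕ, R ≤ reg.a k * (2 * S + 1) → let N : ℕ := 2 * S + 1; let mq : Fin Nf → ℝ := fun f => reg.mcrit k + reg.a k * m f / reg.Zm k; let wt : GaugeConfig 4 N (Matrix.specialUnitaryGroup (Fin 3) ℂ) → ℝ := fun U => ∏ f, ‖fermionDet (wilsonDirac (fundamentalRep (Fin 3)) U (mq f) 1)‖; (1 / 4 : ℝ) ≤ (∫ U, (if (fermionDet (wilsonDirac (fundamentalRep (Fin 3)) U (reg.mcrit k - reg.a k * M / reg.Zm k) 1)).re < 0 then (1 : ℝ) else 0) * wt U ∂(wilsonMeasure (d := 4) (L := N) (fundamentalRep (Fin 3)) (reg.β k))) / (∫ U, wt U ∂(wilsonMeasure (d := 4) (L := N) (fundamentalRep (Fin 3)) (reg.β k))))) → ∃ M₁ : ℝ, M₀ ≤ M₁ ∧ ∃ ℓ' : ℝ, 0 < ℓ' ∧ ℓ' ≤ ℓ ∧ ∀ m : Fin Nf → ℝ, (∀ f, M₁ < m f) → ∃ R : ℝ, 0 < R ∧ ∃ S₀ : ℕ, ∃ C : ℝ, 0 < C ∧ ∃ α : ℝ,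 0 < α ∧ ∀ᶠ k : ℕ in Filter.atTop, ∀ S : ℕ, R ≤ reg.a k * (2 * S + 1) → let N : ℕ := 2 * S + 1; let mq : Fin Nf → ℝ := fun f => reg.mcrit k + reg.a k * m f / reg.Zm k; let wt : GaugeConfig 4 N (Matrix.specialUnitaryGroup (Fin 3) ℂ) → ℝ := fun U => ∏ f, ‖fermionDet (wilsonDirac (fundamentalRep (Fin 3)) U (mq f) 1)‖; let P : (GaugeConfig 4 N (Matrix.specialUnitaryGroup (Fin 3) ℂ) → Prop) → ℝ := fun E => (∫ U, (if E U then (1 : ℝ) else 0) * wt U ∂(wilsonMeasure (d := 4) (L := N) (fundamentalRep (Fin 3)) (reg.β k))) / (∫ U, wt U ∂(wilsonMeasure (d := 4) (L := N) (fundamentalRep (Fin 3)) (reg.β k))); ∀ s : Fin 4 → ℕ, (∀ i, b₀ ≤ s i ∧ s i ≤ N ∧ (s i : ℝ) * reg.a k ≤ ℓ') → (∀ i, S₀ ≤ s i) → (∀ i j, s i ≤ 2 * s j) → ∀ f : Fin Nf, ∀ t : ℝ, 0 < t → t ≤ 1 → P (fun U => HasSingularSeparator U (mq f) s (t / s 0))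 ≤ C * t ^ α

/-! ## §3 First lemmas (PROVED): Markov by factorisation, Markov in ratio form, the two-regime splice -/

/-- **Markov by factorisation.** On any measure space, if `X, R ≥ 0` and `R` is integrable, then for every
`δ ≥ 0` the `X·R`-mass of the event `{X < δ}` is at most `δ · ∫ R`. With `X·R =` the phase-quenched weight and
`X = σ_min` of the torus Schur complement onto `Σ` this is `P_pq(σ_min < δ) · Z_pq ≤ δ · ∫ R`, i.e.
`P_pq(‖(D_T⁻¹)_ΣΣ‖ > 1/δ) ≤ δ · E_pq‖(D_T⁻¹)_ΣΣ‖` with `E_pq‖(D_T⁻¹)_ΣΣ‖ = (∫ R)/Z_pq` FINITE for free — the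
sea determinant cancels the pole of its own propagator. -/
theorem weightedMass_lt_le_of_factorisation {Ω : Type*} [MeasurableSpace Ω] (μ : Measure Ω)
    {X R : Ω → ℝ} (hX : ∀ ω, 0 ≤ X ω) (hR : ∀ ω, 0 ≤ R ω) (hRi : Integrable R μ) {δ : ℝ}
    (hδ : 0 ≤ δ) :
    ∫ ω, (if X ω < δ then (1 : ℝ) else 0) * (X ω * R ω) ∂μ ≤ δ * ∫ ω, R ω ∂μ := by
  rw [← integral_const_mul]
  refine integral_mono_of_nonneg (Filter.Eventually.of_forall fun ω => ?_) (hRi.const_mul δ)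
    (Filter.Eventually.of_forall fun ω => ?_)
  · show (0 : ℝ) ≤ (if X ω < δ then (1 : ℝ) else 0) * (X ω * R ω)
    split_ifs
    · rw [one_mul]; exact mul_nonneg (hX ω) (hR ω)
    · rw [zero_mul]
  · show (if X ω < δ then (1 : ℝ) else 0) * (X ω * R ω) ≤ δ * R ω
    split_ifs with h
    · rw [one_mul]; exact mul_le_mul_of_nonneg_right h.le (hR ω)
    · rw [zero_mul]; exact mul_nonneg hδ (hR ω)

/-- **Markov in ratio form** (used by `stub_coarseOfMomentAndTransfer`): for `F, wt ≥ 0` with `F·wt` integrable,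
a positive level `M` and a positive normaliser, `P_wt(F > M) ≤ (1/M) · E_wt[F]`. -/
theorem ratio_markov {Ω : Type*} [MeasurableSpace Ω] (μ : Measure Ω) {F wt : Ω → ℝ} (hF : ∀ ω, 0 ≤ F ω)
    (hwt : ∀ ω, 0 ≤ wt ω) (hint : Integrable (fun ω => F ω * wt ω) μ) {M : ℝ} (hM : 0 < M)
    (hZ : 0 < ∫ ω, wt ω ∂μ) :
    (∫ ω, (if M < F ω then (1 : ℝ) else 0) * wt ω ∂μ) / (∫ ω, wt ω ∂μ) ≤
      (1 / M) * ((∫ ω, F ω * wt ω ∂μ) / (∫ ω, wt ω ∂μ)) := by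
  rw [← mul_div_assoc]
  refine div_le_div_of_nonneg_right ?_ hZ.le
  rw [← integral_const_mul]
  refine integral_mono_of_nonneg (Filter.Eventually.of_forall fun ω => ?_) (hint.const_mul (1 / M))
    (Filter.Eventually.of_forall fun ω => ?_)
  · show (0 : ℝ) ≤ (if M < F ω then (1 : ℝ) else 0) * wt ω
    split_ifs
    · rw [one_mul]; exact hwt ω
    · rw [zero_mul]
  · show (if M < F ω then (1 : ℝ) else 0) * wt ω ≤ 1 / M * (F ω * wt ω)
    split_ifs with h
    · rw [one_mul, ← mul_assoc]
      have h1 : (1 : ℝ) ≤ 1 / M * F ω := by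
        rw [one_div, ← div_eq_inv_mul, le_div_iff₀ hM, one_mul]; exact h.le
      calc wt ω = 1 * wt ω := (one_mul _).symm
        _ ≤ (1 / M * F ω) * wt ω := mul_le_mul_of_nonneg_right h1 (hwt ω)
    · rw [zero_mul]; exact mul_nonneg (by positivity) (mul_nonneg (hF ω) (hwt ω))

/-- **The two-regime splice** (card `two-regime-splice`, pure real analysis). Let `P : ℝ → ℝ` be monotone on the
positive levels (the probability of an event increasing in the level `t > 0`). Suppose a COARSE law `P t ≤ A t^α`
on `[t₁, 1]` (`0 < t₁ ≤ 1`) and a FINE law `P t ≤ B t₁^(−p) t^α₀` on `(0, 1]` whose constant is polynomially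
large in `1/t₁`. Then ONE power law holds on all of `(0, 1]`: `P t ≤ max A B · t^α'` with
`α' = min α (α α₀/(α + p))` — constant and exponent independent of `t₁`. With `t₁ = a_k^γ` this is how a
`k`-uniform law above resolution `a_k^γ` and a fixed-cutoff Wegner bound with constants polynomial in `1/a_k`
give clause (i) for all `t ∈ (0,1]`, uniformly in `k`. -/
theorem splice {P : ℝ → ℝ} {A B t₁ p α α₀ : ℝ} (hmono : ∀ ⦃t t' : ℝ⦄, 0 < t → t ≤ t' → P t ≤ P t')
    (hA : 0 ≤ A) (hB : 0 ≤ B) (ht₁ : 0 < t₁) (ht₁' : t₁ ≤ 1) (hp : 0 ≤ p) (hα : 0 < α) (hα₀ : 0 < α₀)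
    (hcoarse : ∀ t, t₁ ≤ t → t ≤ 1 → P t ≤ A * t ^ α)
    (hfine : ∀ t, 0 < t → t ≤ 1 → P t ≤ B * t₁ ^ (-p) * t ^ α₀) :
    ∀ t, 0 < t → t ≤ 1 → P t ≤ max A B * t ^ (min α (α * α₀ / (α + p))) := by
  intro t ht0 ht1
  set α' : ℝ := min α (α * α₀ / (α + p)) with hα'def
  have hαp : 0 < α + p := by linarith
  have hα'pos : 0 < α' := lt_min hα (div_pos (mul_pos hα hα₀) hαp)
  have hα'le : α' ≤ α := min_le_left _ _
  have hα'le2 : α' ≤ α * α₀ / (α + p) := min_le_right _ _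
  have hkey : α' * (α + p) ≤ α * α₀ := (le_div_iff₀ hαp).mp hα'le2
  have htα' : 0 < t ^ α' := Real.rpow_pos_of_pos ht0 α'
  by_cases hcase : t₁ ≤ t
  · -- coarse regime
    calc P t ≤ A * t ^ α := hcoarse t hcase ht1
      _ ≤ A * t ^ α' := mul_le_mul_of_nonneg_left (Real.rpow_le_rpow_of_exponent_ge ht0 ht1 hα'le) hA
      _ ≤ max A B * t ^ α' := mul_le_mul_of_nonneg_right (le_max_left A B) htα'.le
  · push Not at hcase
    by_cases hsub : t₁ ^ α ≤ t ^ α'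
    · -- the coarse law at `t₁` already beats `t^α'`
      calc P t ≤ P t₁ := hmono ht0 hcase.le
        _ ≤ A * t₁ ^ α := hcoarse t₁ le_rfl ht₁'
        _ ≤ A * t ^ α' := mul_le_mul_of_nonneg_left hsub hA
        _ ≤ max A B * t ^ α' := mul_le_mul_of_nonneg_right (le_max_left A B) htα'.le
    · -- the fine law, with the polynomial loss absorbed
      push Not at hsub
      have hbase : t ^ (α' / α) < t₁ := by
        have h1 : (t ^ (α' / α)) ^ α = t ^ α' := by
          rw [← Real.rpow_mul ht0.le]; congr 1; field_simp
        have h2 : (t ^ (α' / α)) ^ α < t₁ ^ α := by rw [h1]; exact hsub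
        exact (Real.rpow_lt_rpow_iff (Real.rpow_nonneg ht0.le _) ht₁.le hα).mp h2
      have hneg : t₁ ^ (-p) ≤ (t ^ (α' / α)) ^ (-p) :=
        Real.rpow_le_rpow_of_nonpos (Real.rpow_pos_of_pos ht0 _) hbase.le (by linarith)
      have hneg' : (t ^ (α' / α)) ^ (-p) = t ^ (-(p * α' / α)) := by
        rw [← Real.rpow_mul ht0.le]; congr 1; ring
      have hexp : α' ≤ -(p * α' / α) + α₀ := by
        have hid : -(p * α' / α) + α₀ - α' = (α * α₀ - α' * (α + p)) / α := by
          field_simp; ring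
        have : 0 ≤ -(p * α' / α) + α₀ - α' := by
          rw [hid]; exact div_nonneg (by linarith) hα.le
        linarith
      have htα₀ : 0 ≤ t ^ α₀ := Real.rpow_nonneg ht0.le α₀
      calc P t ≤ B * t₁ ^ (-p) * t ^ α₀ := hfine t ht0 ht1
        _ ≤ B * (t ^ (α' / α)) ^ (-p) * t ^ α₀ := by
            apply mul_le_mul_of_nonneg_right _ htα₀
            exact mul_le_mul_of_nonneg_left hneg hB
        _ = B * t ^ (-(p * α' / α) + α₀) := by
            rw [hneg', mul_assoc, ← Real.rpow_add ht0]
        _ ≤ B * t ^ α' :=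
            mul_le_mul_of_nonneg_left (Real.rpow_le_rpow_of_exponent_ge ht0 ht1 hexp) hB
        _ ≤ max A B * t ^ α' := mul_le_mul_of_nonneg_right (le_max_right A B) htα'.le

/-! ## §4 Registered stubs (`sorry` lives only here) -/

/-- **Stub 0 — `sheetGreenIntegrable` (bookkeeping; provable now; size M; delegated).** Measurability of
`U ↦ ‖(D_T(U, μ)⁻¹)_ΣΣ‖` and integrability of `‖(D_T(m_f)⁻¹)_ΣΣ‖ · ∏_{f'} |det D_T(m_{f'})|` against the Wilson
measure (bounded: `|det D| · D⁻¹ = adj D` entrywise polynomial in the unitary link entries; Mathlib's inverse is `0`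
on `{det = 0}`). Leans on: `measurable_norm_det_diracMatrix`, `integrable_norm_det_diracMatrix` (tree),
`Matrix.inv_def`/`Matrix.adjugate`, continuity of `U ↦ wilsonDirac … U μ 1` in the link entries. -/
theorem stub_sheetGreenIntegrable : SheetGreenIntegrable := by
  sorry

/-- **Stub 1 — `torusSheetMoment` (M_Σ; research, the heart of the line; size XL; MINE).** See the def. Why it
might fail: a `k`-uniform first-moment budget needs (a) the unquenched sheet-weighted density of states of
`Q_T = Γ₅D_T(m_f)` at the sea mass to have `∫ ρ(E) dE/E ≲ s₀` uniformly in `a_k` and in the volume (no Aoki finger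
at the valence line; Banks–Casher bookkeeping `O(Z_m)`), and (b) every artefact carrier's crossing mass not to be
fine-tuned to the valence line in mean under the one-mode-quenched ensemble. Leans on (unproved physics): carrier
count (route L5), Banks–Casher-type finiteness at positive sea mass, small-field structure of the phase-quenched
SU(3) measure up to the window scale (Bałaban). -/
theorem stub_torusSheetMoment : TorusSheetMoment := by
  sorry

/-- **Stub 2 — `wallTransfer` (T; research; size L–XL; delegated).** See the def. Why it might fail: a sub-gap
Dirichlet direction carried by a lump sitting ON the outer wall is torus-invisible (its torus partner crosses far
from the valence line); the claim is that such positions are a `t^{α_w}`-small fraction on the coarse levels —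
which needs translation averaging of the box position (card `sheet-sweep-translation`'s
`PhaseQuenchedTranslationInvariance`) and a deterministic second-order (Temple–Kato) wall-shift estimate. -/
theorem stub_wallTransfer : WallTransfer := by
  sorry

/-- **Stub 3 — `fineRegimeLaw` (F; research at fixed cutoff; size L–XL; delegated).** See the def. Why it might
fail: the exponent `α₀` must not depend on `k` although the box has `≍ (ℓ/a_k)⁴` sites (Łojasiewicz exponents
degrade with the degree); the Erdős–Hasler squared-gradient floor over ALL near-zero modes of a Dirichlet Wilson cell
is unproved (a common zero of all single-link Hellmann–Feynman responses would kill `α₀ = 1`). -/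
theorem stub_fineRegimeLaw : FineRegimeLaw := by
  sorry

/-- **Stub 4 — `coarseOfMomentAndTransfer` (bookkeeping; provable now; size M; delegated).** Markov in ratio form
(`ratio_markov`) on (M_Σ) at level `M = s₀/(C_w t)` plus the union bound
`{HSS} ⊆ {HSS ∧ ‖G‖ ≤ s₀/(C_w t)} ∪ {s₀/(C_w t) < ‖G‖}` over two MEASURABLE events
(`measurableSet_hasSingularSeparator` p132904; `SheetGreenIntegrable` (a)), giving
`P ≤ B t^{α_w} + C_w C t ≤ (B + C_w C) t^{min α_w 1}` on `t ∈ [a_k^γ, 1]`; the normaliser `Z = ∫ wt` is either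
positive (Markov) or zero (all ratios vanish, `x / 0 = 0`). Witnesses: `R = max`, `S₀ = max`, `γ =` (T)'s. -/
theorem stub_coarseOfMomentAndTransfer : SheetGreenIntegrable → TorusSheetMoment → WallTransfer → CoarseLaw := by
  sorry

/-- **Stub 5 — `lawOfCoarseAndFine` (bookkeeping; provable now; size M; delegated).** `splice` with `t₁ = a_k^γ`
(`0 < a_k ≤ 1` eventually, `reg.a_pos`, `reg.tendsto_a`), `p ↦ p/γ` (`a_k^{-p} = t₁^{-p/γ}`), the level
monotonicity `separatorRatio_mono` (p132904, `Theorems/NestedDissectionSeaCoerciveSeaMeasurableSeparator.lean`) for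
`hmono`, and `R = max`, `S₀ = max`; exponent `min α (α α₀/(α + p/γ))`, constant `max A B`. -/
theorem stub_lawOfCoarseAndFine : CoarseLaw → FineRegimeLaw → SeparatorLawOnBranch := by
  sorry

/-- **Stub 6 — `pinnedDilutionOnPhysicalBranch` (EXTERNAL IMPORT: item 13900 `NegativeCellsDilute` + the
physical-branch clause `mcrit k → 0`; the same registered external stub as in 13901's line
`chirality-collapses-pseudospectrum`; open, crux-grade, NOT this line's work — never briefed).** See the def. -/
theorem stub_pinnedDilutionOnPhysicalBranch : PinnedDilutionOnPhysicalBranch := by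
  sorry

/-! ## §5 The composition (sorry-free): the stubs imply the crux, by name -/

/-- **Transfer, first leg: `SeparatorLawOnBranch → SeparatorLawLarge`** (weakening: forget the pinned-dilute
hypothesis, `M₁ = M₀`, `ℓ' = ℓ`, and `b₀ ≤ s_i` gives `2 ≤ s_i`). -/
theorem separatorLawLarge_of_onBranch (h : SeparatorLawOnBranch) : SeparatorLawLarge := by
  intro Nf reg hNf hms has hcrit M₀ hM₀ b₀ hb₀ ℓ hℓ _hbody
  refine ⟨M₀, le_rfl, ℓ, hℓ, le_rfl, fun m hmm => ?_⟩
  have hm0 : ∀ f, 0 < m f := fun f => hM₀.trans_lt (hmm f)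
  obtain ⟨R, hR, S₀, C, hC, α, hα, hk⟩ := h Nf reg hNf hms has hcrit ℓ hℓ m hm0
  refine ⟨R, hR, S₀, C, hC, α, hα, ?_⟩
  filter_upwards [hk] with k hk
  intro S hS
  have hk' := hk S hS
  dsimp only at hk' ⊢
  intro s hs hS₀ hcub f t ht0 ht1
  exact hk' s (fun i => ⟨hb₀.trans (hs i).1, (hs i).2.1, (hs i).2.2⟩) hS₀ hcub f t ht0 ht1

/-- **The crux from the stubs, BY NAME.** `CoarseLaw` from stubs 0, 1, 2 by stub 4; `SeparatorLawOnBranch` from it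
and stub 3 by stub 5; `SeparatorLawLarge` by weakening; `CoerciveSea` by the landed composition
`coerciveSea_of_pinnedDilutionOnBranch_of_separatorLawLarge` (p108820) with the external stub 6; the crux by
`coerciveOfDilute_of_coerciveSea` (p87837). -/
theorem CoerciveOfDilute_of : Summit.QuantumFields.QCD.Theses.NestedDissectionSea.CoerciveOfDilute :=
  coerciveOfDilute_of_coerciveSea
    (coerciveSea_of_pinnedDilutionOnBranch_of_separatorLawLarge stub_pinnedDilutionOnPhysicalBranch
      (separatorLawLarge_of_onBranch
        (stub_lawOfCoarseAndFine
          (stub_coarseOfMomentAndTransfer stub_sheetGreenIntegrable stub_torusSheetMoment stub_wallTransfer)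
          stub_fineRegimeLaw)))

end Summit.QuantumFields.QCD.Cruxes.CoerciveOfDilute.SeaPaysPoles

end
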